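import Mathlib.Analysis.Normed.Group.FunctionSeries
import Literature.Analysis.FunctionSpaces.TorusFourierConvolution
import Literature.Analysis.FunctionSpaces.TorusFourierSeries
import Literature.Analysis.FunctionSpaces.TorusSpaceTimeKernel
import HarnessLib

/-!
# The smooth inverse Laplacian on the flat torus `T^d`

Analysis/FunctionSpaces support file. On the flat torus every smooth function `h` has a smooth
potential `Δ⁻¹h` with `Δ(Δ⁻¹h) = h - ⨍ h` and zero mean (Cheskidov–Luo 2022, App. B = §7.2:
"For any `f ∈ C^∞(𝕋^d)` there exists a `v ∈ C₀^∞(𝕋^d)` such that `Δv = f - ⨍ f`, and we denote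
`v` by `Δ⁻¹f`"; Grafakos 2014, Prop. 3.1.2 (10): on Fourier coefficients `Δ` is multiplication
by `-4π²|k|²`). This file constructs `Δ⁻¹` as an honest operator on functions — not on `L²`
classes — so that it can be fed into *classical* PDE constructions (the De Lellis–Székelyhidi
antidivergence `ℛ`, CL22 Def. 7.2, built from `Δ⁻¹`, `Δ⁻²` and `∂ᵢ`), including the joint
space–time smoothness of `t ↦ Δ⁻¹(g t)` for jointly smooth `g` on `[0, T] × T^d`.

## Construction

With `N = #d`, the multiplier `|k|^{-2N}` is absolutely summable over `ℤ^d ∖ {0}`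
(`Torus.summable_invLaplacianSymbol`, comparison with `∑ (1+|k|²)^{-N} < ∞` of
`TorusFourierSeries`), so `K = ∑_{k ≠ 0} |k|^{-2N} e_k` is a **continuous real kernel**
(`Torus.invLaplacianKernel`; uniform convergence) with `𝓕K(k) = |k|^{-2N}` (`k ≠ 0`), `𝓕K(0) = 0`
(`Torus.mFourierCoeff_invLaplacianKernel`, term-wise integration). Then

  `Δ⁻¹ h := ((-4π²)^N)⁻¹ • K ⋆ Δ^{N-1} h`     (`Torus.invLaplacian`)

is `(-4π²)^{-N} Δ^{-N} Δ^{N-1} = Δ⁻¹` on Fourier coefficients: by the convolution theorem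
(`Torus.mFourierCoeff_convolution`, Grafakos 2014, Prop. 3.1.2 (9)) and `𝓕(Δw)(k) = -4π²|k|² 𝓕w(k)`
(`Torus.mFourierCoeff_laplacian_complex`, Prop. 3.1.2 (10)), `𝓕(Δ Δ⁻¹h)(k) = 𝓕h(k)` for `k ≠ 0`
and `= 0` for `k = 0`, whence `Δ(Δ⁻¹ h) = h - ∫ h` by uniqueness of Fourier coefficients of
continuous functions (`Torus.eq_of_forall_mFourierCoeff_eq`, Prop. 3.2.4). All derivatives fall on the smooth
factor of the convolution, so smoothness (`Torus.isSmooth_invLaplacian`) and **joint space–time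
smoothness** (`Torus.IsSmoothSpaceTimeOn.invLaplacian`, from `TorusSpaceTimeKernel`) are those of
mollifications; `∫ Δ⁻¹h = 0` (`Torus.integral_invLaplacian`).

## Main statements (all proved)

* `Torus.invLaplacianSymbol`, `Torus.summable_invLaplacianSymbol`; `Torus.invLaplacianKernelC`,
  `Torus.invLaplacianKernel` (continuous, real, `𝓕K = symbol`, `∫ K = 0`);
* `Torus.invLaplacian` with `Torus.isSmooth_invLaplacian`, `Torus.laplacian_invLaplacian`
  (`Δ(Δ⁻¹h) = h - ∫ h` for smooth real `h`, `d` nonempty), `Torus.integral_invLaplacian`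
  (zero mean), `Torus.invLaplacian_const_smul`, and `Torus.IsSmoothSpaceTimeOn.invLaplacian`
  (joint space–time smoothness on convex time sets with nonempty interior).

The Fourier toolkit used (uniqueness of coefficients of continuous functions, the convolution
theorem, `𝓕(Δⁿw) = (-4π²|k|²)ⁿ𝓕w`, complexification lemmas) is `TorusFourierConvolution`.

The definition `Torus.invLaplacian` is stated for functions with values in any real normed space
(componentwise it is the same operator); the identity `Δ Δ⁻¹ h = h - ∫ h` is proved for
real-valued `h`, which is what the consumers (scalar potentials, vector fields treated
coordinate-wise) use.

## Mathlib search

Mathlib (this pin) has multiple Fourier series on `UnitAddTorus` (`mFourier`, `mFourierCoeff`,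
`mFourierBasis`, `hasSum_mFourier_series_of_summable`) but no inverse Laplacian / Fourier
multiplier operators on the torus and no convolution theorem for `mFourierCoeff` (searched
`mFourierCoeff_conv`, `invLaplacian`, `fourierMultiplier` + `Torus`: nothing outside
`Literature/`, where `FracLaplacianSmooth` treats `(-Δ)^α`, `α ≥ 0`, by the series directly).

## References

* A. Cheskidov, X. Luo, *Sharp nonuniqueness for the Navier–Stokes equations*, Invent. Math. 229
  (2022) 987–1054 = arXiv:2009.06596, §7.2 (App. B): `Δ⁻¹` on `C^∞(𝕋^d)`. [`CheskidovLuo2022`]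
* L. Grafakos, *Classical Fourier Analysis*, 3rd ed., GTM 249 (Springer 2014), Prop. 3.1.2 (9),
  (10) (PDF p. 188), Prop. 3.2.4 (PDF p. 194), Prop. 3.2.7 (1) (PDF p. 195). [`Grafakos2014`]
-/

noncomputable section

open MeasureTheory Set Filter Topology UnitAddTorus Function
open scoped Convolution ContDiff ComplexConjugate ENNReal

namespace Literature.Analysis.FunctionSpaces

namespace Torus

variable {d : Type*} [Fintype d]

/-! ## The kernel of `Δ^{-N}`, `N = #d` -/

section Kernel

/-- The symbol of `(-Δ/4π²)^{-N}` off the zero mode, `N = #d`: `|k|^{-2N}` (and the junk value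
`(0^N)⁻¹ = 0` at `k = 0` when `d` is nonempty). [folklore] -/
def invLaplacianSymbol (k : d → ℤ) : ℝ :=
  (freqNormSq k ^ Fintype.card d)⁻¹

/-- The symbol is nonnegative. [folklore] -/
theorem invLaplacianSymbol_nonneg (k : d → ℤ) : 0 ≤ invLaplacianSymbol k :=
  inv_nonneg.2 (pow_nonneg (freqNormSq_nonneg k) _)

/-- The symbol vanishes at the zero frequency (`d` nonempty). [folklore] -/
theorem invLaplacianSymbol_zero [Nonempty d] : invLaplacianSymbol (0 : d → ℤ) = 0 := by
  rw [invLaplacianSymbol, freqNormSq_zero, zero_pow Fintype.card_ne_zero, inv_zero]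

/-- The symbol is even. [folklore] -/
theorem invLaplacianSymbol_neg (k : d → ℤ) : invLaplacianSymbol (-k) = invLaplacianSymbol k := by
  rw [invLaplacianSymbol, invLaplacianSymbol, freqNormSq_neg]

omit [Fintype d] in
/-- Nonzero lattice points have `|k|² ≥ 1`. [folklore] -/
theorem one_le_freqNormSq_of_ne_zero [Fintype d] {k : d → ℤ} (hk : k ≠ 0) : 1 ≤ freqNormSq k := by
  obtain ⟨i, hi⟩ : ∃ i, k i ≠ 0 := by
    by_contra h
    exact hk (funext fun i => by simpa using not_exists.1 h i)
  have h1 : (1 : ℝ) ≤ ((k i : ℝ)) ^ 2 := by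
    have : (1 : ℤ) ≤ (k i) ^ 2 := by
      have h0 : 0 < (k i) ^ 2 := by positivity
      omega
    exact_mod_cast this
  exact h1.trans (Finset.single_le_sum (f := fun j => ((k j : ℝ)) ^ 2) (fun j _ => sq_nonneg _)
    (Finset.mem_univ i))

/-- Comparison with the summable weights of `TorusFourierSeries`:
`|k|^{-2N} ≤ 2^N (1 + |k|²)^{-N}`. [folklore] -/
theorem invLaplacianSymbol_le (k : d → ℤ) :
    invLaplacianSymbol k ≤ 2 ^ Fintype.card d * ((1 + freqNormSq k) ^ Fintype.card d)⁻¹ := by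
  set N := Fintype.card d with hN
  by_cases hk : k = 0
  · subst hk
    rw [invLaplacianSymbol, freqNormSq_zero, add_zero, one_pow, inv_one, mul_one]
    rcases Nat.eq_zero_or_pos N with h0 | hpos
    · rw [← hN, h0, pow_zero, pow_zero, inv_one]
    · rw [← hN, zero_pow hpos.ne', inv_zero]
      positivity
  · have h1 : 1 ≤ freqNormSq k := one_le_freqNormSq_of_ne_zero hk
    have hpos : 0 < freqNormSq k := by linarith
    have h2 : (1 + freqNormSq k) ^ N ≤ 2 ^ N * freqNormSq k ^ N := by
      rw [← mul_pow]
      exact pow_le_pow_left₀ (by linarith) (by linarith) N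
    rw [invLaplacianSymbol, ← hN]
    calc (freqNormSq k ^ N)⁻¹ = 2 ^ N * (2 ^ N * freqNormSq k ^ N)⁻¹ := by
          rw [mul_inv, ← mul_assoc, mul_inv_cancel₀ (by positivity), one_mul]
      _ ≤ 2 ^ N * ((1 + freqNormSq k) ^ N)⁻¹ :=
          mul_le_mul_of_nonneg_left (inv_anti₀ (by positivity) h2) (by positivity)

/-- **The symbol `|k|^{-2N}`, `N = #d`, is absolutely summable over `ℤ^d`.** [folklore] -/
theorem summable_invLaplacianSymbol : Summable (invLaplacianSymbol (d := d)) :=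
  Summable.of_nonneg_of_le invLaplacianSymbol_nonneg invLaplacianSymbol_le
    (summable_inv_one_add_freqNormSq_pow_card.mul_left _)

/-- The kernel of `Δ^{-N}` up to normalisation, as a complex Fourier series:
`K_ℂ(x) = ∑_k |k|^{-2N} e_k(x)`. [folklore] -/
def invLaplacianKernelC (x : UnitAddTorus d) : ℂ :=
  ∑' k : d → ℤ, (invLaplacianSymbol k : ℂ) * mFourier k x

/-- The terms of the kernel series have norm `|k|^{-2N}`. [folklore] -/
theorem norm_invLaplacianSymbol_mul_mFourier (k : d → ℤ) (x : UnitAddTorus d) :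
    ‖(invLaplacianSymbol k : ℂ) * mFourier k x‖ = invLaplacianSymbol k := by
  rw [norm_mul, norm_mFourier_apply, mul_one, Complex.norm_real, Real.norm_eq_abs,
    abs_of_nonneg (invLaplacianSymbol_nonneg k)]

/-- The kernel series converges absolutely at every point. [folklore] -/
theorem summable_invLaplacianKernelC_term (x : UnitAddTorus d) :
    Summable fun k : d → ℤ => (invLaplacianSymbol k : ℂ) * mFourier k x :=
  Summable.of_norm (by simpa only [norm_invLaplacianSymbol_mul_mFourier] using
    summable_invLaplacianSymbol)

/-- **The kernel is continuous** (uniformly convergent series of characters). [folklore] -/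
theorem continuous_invLaplacianKernelC : Continuous (invLaplacianKernelC (d := d)) :=
  continuous_tsum (fun k => continuous_const.mul (mFourier k).continuous)
    summable_invLaplacianSymbol fun k x => (norm_invLaplacianSymbol_mul_mFourier k x).le

/-- **The kernel is real**: `conj K_ℂ = K_ℂ` (the symbol is real and even; reindex `k ↦ -k`). [folklore] -/
theorem conj_invLaplacianKernelC (x : UnitAddTorus d) :
    conj (invLaplacianKernelC x) = invLaplacianKernelC x := by
  rw [invLaplacianKernelC, Complex.conj_tsum]
  simp only [map_mul, Complex.conj_ofReal, ← mFourier_neg]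
  rw [show (fun k : d → ℤ => (invLaplacianSymbol k : ℂ) * mFourier (-k) x) =
      (fun k : d → ℤ => (invLaplacianSymbol k : ℂ) * mFourier k x) ∘ (Equiv.neg (d → ℤ)) from
    funext fun k => by simp [invLaplacianSymbol_neg]]
  exact (Equiv.neg (d → ℤ)).tsum_eq fun k : d → ℤ => (invLaplacianSymbol k : ℂ) * mFourier k x

/-- **The inverse-Laplacian kernel** `K = ∑_{k ≠ 0} |k|^{-2N} e_k` (`N = #d`), a continuous real
function on `T^d` (the real part of `invLaplacianKernelC`, which is already real). [folklore] -/
def invLaplacianKernel (x : UnitAddTorus d) : ℝ :=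
  (invLaplacianKernelC x).re

/-- `(K x : ℂ) = K_ℂ x`. [folklore] -/
theorem ofReal_invLaplacianKernel (x : UnitAddTorus d) :
    ((invLaplacianKernel x : ℝ) : ℂ) = invLaplacianKernelC x :=
  Complex.conj_eq_iff_re.1 (conj_invLaplacianKernelC x)

/-- The kernel is continuous. [folklore] -/
theorem continuous_invLaplacianKernel : Continuous (invLaplacianKernel (d := d)) :=
  Complex.continuous_re.comp continuous_invLaplacianKernelC

/-- The kernel is integrable. [folklore] -/
theorem integrable_invLaplacianKernel : Integrable (invLaplacianKernel (d := d)) volume :=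
  continuous_invLaplacianKernel.integrable_unitAddTorus

/-- **Fourier coefficients of the kernel**: `𝓕K_ℂ(l) = |l|^{-2N}` (`l ≠ 0`), `𝓕K_ℂ(0) = 0`
(term-wise integration of the absolutely convergent series, orthonormality of the characters). [folklore] -/
theorem mFourierCoeff_invLaplacianKernelC (l : d → ℤ) :
    mFourierCoeff (invLaplacianKernelC (d := d)) l = invLaplacianSymbol l := by
  classical
  rw [mFourierCoeff_eq_integral_conj_mul]
  have hterm : ∀ x : UnitAddTorus d, conj (mFourier l x) * invLaplacianKernelC x =
      ∑' k : d → ℤ, (invLaplacianSymbol k : ℂ) * (conj (mFourier l x) * mFourier k x) := by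
    intro x
    rw [invLaplacianKernelC, ← tsum_mul_left]
    exact tsum_congr fun k => by ring
  simp_rw [hterm]
  have hmeas : ∀ k : d → ℤ, AEStronglyMeasurable
      (fun x : UnitAddTorus d => (invLaplacianSymbol k : ℂ) * (conj (mFourier l x) * mFourier k x))
      volume := fun k =>
    (continuous_const.mul ((mFourier l).continuous.star.mul (mFourier k).continuous)).aestronglyMeasurable
  have hnorm : ∀ (k : d → ℤ) (x : UnitAddTorus d),
      ‖(invLaplacianSymbol k : ℂ) * (conj (mFourier l x) * mFourier k x)‖ₑ =
        ENNReal.ofReal (invLaplacianSymbol k) := by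
    intro k x
    rw [← ofReal_norm, norm_mul, norm_mul, RCLike.norm_conj, norm_mFourier_apply, norm_mFourier_apply,
      mul_one, mul_one, Complex.norm_real, Real.norm_eq_abs, abs_of_nonneg (invLaplacianSymbol_nonneg k)]
  have hsum : ∑' k : d → ℤ, ∫⁻ x : UnitAddTorus d,
      ‖(invLaplacianSymbol k : ℂ) * (conj (mFourier l x) * mFourier k x)‖ₑ ≠ ⊤ := by
    simp_rw [hnorm, lintegral_const, measure_univ, mul_one]
    rw [← ENNReal.ofReal_tsum_of_nonneg invLaplacianSymbol_nonneg summable_invLaplacianSymbol]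
    exact ENNReal.ofReal_ne_top
  rw [integral_tsum hmeas hsum]
  simp_rw [integral_const_mul, integral_conj_mFourier_mul_mFourier]
  rw [tsum_eq_single l fun k hk => by rw [if_neg (Ne.symm hk), mul_zero]]
  rw [if_pos rfl, mul_one]

/-- Fourier coefficients of the real kernel: `𝓕K(l) = |l|^{-2N}` off `0`, `0` at `0`. [folklore] -/
theorem mFourierCoeff_invLaplacianKernel (l : d → ℤ) :
    mFourierCoeff (fun x => ((invLaplacianKernel (d := d) x : ℝ) : ℂ)) l = invLaplacianSymbol l := by
  rw [show (fun x => ((invLaplacianKernel (d := d) x : ℝ) : ℂ)) = invLaplacianKernelC from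
    funext ofReal_invLaplacianKernel]
  exact mFourierCoeff_invLaplacianKernelC l

/-- The kernel has zero mean (`d` nonempty): `∫ K = 𝓕K(0) = 0`. [folklore] -/
theorem integral_invLaplacianKernel [Nonempty d] : ∫ x, invLaplacianKernel (d := d) x = 0 := by
  have h := mFourierCoeff_invLaplacianKernel (d := d) 0
  rw [invLaplacianSymbol_zero, mFourierCoeff_eq_integral_conj_mul] at h
  simp only [mFourier_zero, ContinuousMap.one_apply, map_one, one_mul] at h
  rw [integral_complex_ofReal] at h
  exact_mod_cast h

end Kernel

/-! ## The inverse Laplacian -/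

section InvLaplacian

variable {F : Type*} [NormedAddCommGroup F] [NormedSpace ℝ F]

/-- **The inverse Laplacian on the flat torus** (Cheskidov–Luo 2022, §7.2: `Δ⁻¹f` is the
zero-mean solution of `Δv = f - ⨍f`), as the honest operator
`Δ⁻¹ h = ((-4π²)^N)⁻¹ • K ⋆ Δ^{N-1} h`, `N = #d`, `K = Torus.invLaplacianKernel` (symbol
`|k|^{-2N}` off the zero mode): on Fourier coefficients this is `𝓕h(k)/(-4π²|k|²)` for `k ≠ 0`
and `0` at `k = 0`. Stated for functions with values in any real normed space (it acts
componentwise); meaningful on smooth `h` (`Torus.laplacian_invLaplacian`). [cite: CheskidovLuo2022, §7.2] -/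
def invLaplacian (h : UnitAddTorus d → F) : UnitAddTorus d → F :=
  ((-(4 * Real.pi ^ 2)) ^ Fintype.card d)⁻¹ • (invLaplacianKernel ⋆ (laplacian^[Fintype.card d - 1] h))

/-- **`Δ⁻¹h` is smooth for smooth `h`** (a mollification of the smooth `Δ^{N-1}h` by the
integrable kernel `K`). [cite: CheskidovLuo2022, §7.2] -/
theorem isSmooth_invLaplacian {h : UnitAddTorus d → F} (hh : IsSmooth h) : IsSmooth (invLaplacian h) :=
  (isSmooth_convolution integrable_invLaplacianKernel (isSmooth_laplacian_iterate hh _)).smul _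

/-- `Δ⁻¹` of a constant multiple. [folklore] -/
theorem invLaplacian_const_smul (c : ℝ) (h : UnitAddTorus d → F) (hh : IsSmooth h) :
    invLaplacian (c • h) = c • invLaplacian h := by
  have hit : ∀ n : ℕ, laplacian^[n] (c • h) = c • laplacian^[n] h := by
    intro n
    induction n with
    | zero => rfl
    | succ n ih =>
      rw [iterate_succ_apply', iterate_succ_apply', ih]
      funext x
      exact laplacian_const_smul_apply (isSmooth_laplacian_iterate hh n) c x
  rw [invLaplacian, invLaplacian, hit, convolution_smul, smul_comm]

/-- **`Δ⁻¹h` has zero mean** (`d` nonempty; `∫ (K ⋆ g) = (∫ K)(∫ g) = 0`), i.e.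
`Δ⁻¹ : C^∞ → C₀^∞` as in Cheskidov–Luo 2022, §7.2. [cite: CheskidovLuo2022, §7.2] -/
theorem integral_invLaplacian [Nonempty d] [CompleteSpace F] {h : UnitAddTorus d → F}
    (hh : IsSmooth h) : ∫ x, invLaplacian h x = 0 := by
  rw [invLaplacian]
  simp only [Pi.smul_apply]
  rw [integral_smul, integral_convolution (ContinuousLinearMap.lsmul ℝ ℝ) integrable_invLaplacianKernel
    (isSmooth_laplacian_iterate hh _).integrable, integral_invLaplacianKernel]
  simp

/-- **`Δ(Δ⁻¹ h) = h - ∫ h` for smooth real `h`** (Cheskidov–Luo 2022, §7.2; `d` nonempty). Proof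
on Fourier coefficients: `𝓕(Δ Δ⁻¹h)(k) = -4π²|k|² ((-4π²)^N)⁻¹ |k|^{-2N} (-4π²|k|²)^{N-1} 𝓕h(k)
= 𝓕h(k)` for `k ≠ 0` and `0 = 𝓕h(0) - ∫h` at `k = 0`, then uniqueness of Fourier coefficients of
continuous functions. [cite: CheskidovLuo2022, §7.2] -/
theorem laplacian_invLaplacian [Nonempty d] {h : UnitAddTorus d → ℝ} (hh : IsSmooth h)
    (x : UnitAddTorus d) : laplacian (invLaplacian h) x = h x - ∫ y, h y := by
  classical
  set N := Fintype.card d with hN_def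
  have hN : 1 ≤ N := Fintype.card_pos
  set c : ℝ := ((-(4 * Real.pi ^ 2)) ^ N)⁻¹ with hc_def
  have hc0 : (-(4 * Real.pi ^ 2) : ℝ) ^ N ≠ 0 := pow_ne_zero _ (neg_ne_zero.2 (by positivity))
  -- the smooth factor and the mollification
  set g : UnitAddTorus d → ℝ := laplacian^[N - 1] h with hg_def
  have hg : IsSmooth g := isSmooth_laplacian_iterate hh _
  set u : UnitAddTorus d → ℝ := invLaplacianKernel ⋆ g with hu_def
  have hu : IsSmooth u := isSmooth_convolution integrable_invLaplacianKernel hg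
  have hP : invLaplacian h = c • u := rfl
  -- complexified versions
  set w : UnitAddTorus d → ℂ := fun y => (h y : ℂ) with hw_def
  have hw : IsSmooth w := hh.ofReal
  set gC : UnitAddTorus d → ℂ := laplacian^[N - 1] w with hgC_def
  have hgC : IsSmooth gC := isSmooth_laplacian_iterate hw _
  have hg_gC : (fun y => (g y : ℂ)) = gC := funext (ofReal_laplacian_iterate hh (N - 1))
  set uC : UnitAddTorus d → ℂ := invLaplacianKernel ⋆ gC with huC_def
  have huC : IsSmooth uC := isSmooth_convolution integrable_invLaplacianKernel hgC
  have hu_uC : (fun y => (u y : ℂ)) = uC := by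
    funext y
    rw [hu_def, ofReal_convolution, hg_gC]
  -- the two sides, complexified
  set F₁ : UnitAddTorus d → ℂ := fun y => ((laplacian (invLaplacian h) y : ℝ) : ℂ) with hF₁_def
  set F₂ : UnitAddTorus d → ℂ := fun y => ((h y - ∫ z, h z : ℝ) : ℂ) with hF₂_def
  have hF₁ : F₁ = fun y => (c : ℂ) * laplacian uC y := by
    funext y
    simp only [hF₁_def]
    rw [hP, laplacian_const_smul_apply hu c y, smul_eq_mul, Complex.ofReal_mul,
      ofReal_laplacian hu y, hu_uC]
  have hF₁c : Continuous F₁ := by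
    rw [hF₁]
    exact continuous_const.mul huC.laplacian.continuous
  have hF₂c : Continuous F₂ := Complex.continuous_ofReal.comp (hh.continuous.sub continuous_const)
  -- Fourier coefficients of the two sides
  have hw0 : mFourierCoeff w 0 = ((∫ z, h z : ℝ) : ℂ) := by
    rw [mFourierCoeff_eq_integral_conj_mul]
    simp only [mFourier_zero, ContinuousMap.one_apply, map_one, one_mul, hw_def]
    exact integral_complex_ofReal
  have hcoef : ∀ k, mFourierCoeff F₁ k = mFourierCoeff F₂ k := by
    intro k
    -- abbreviations for the symbol factors, in `ℂ`
    have hL : mFourierCoeff F₁ k = (c : ℂ) * (-(4 * (Real.pi : ℂ) ^ 2 * (freqNormSq k : ℂ))) *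
        (invLaplacianSymbol k : ℂ) * (-(4 * (Real.pi : ℂ) ^ 2 * (freqNormSq k : ℂ))) ^ (N - 1) *
          mFourierCoeff w k := by
      rw [hF₁, show (fun y => (c : ℂ) * laplacian uC y) = (c : ℂ) • laplacian uC from rfl,
        mFourierCoeff_const_smul, smul_eq_mul, mFourierCoeff_laplacian_complex huC, huC_def,
        mFourierCoeff_convolution continuous_invLaplacianKernel hgC.continuous,
        mFourierCoeff_invLaplacianKernel, hgC_def, mFourierCoeff_laplacian_iterate hw k (N - 1)]
      push_cast
      ring
    have hR : mFourierCoeff F₂ k = mFourierCoeff w k - if k = 0 then ((∫ z, h z : ℝ) : ℂ) else 0 := by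
      rw [show F₂ = w - fun _ => ((∫ z, h z : ℝ) : ℂ) from funext fun y => by
          simp [hF₂_def, hw_def],
        mFourierCoeff_sub hw.integrable (integrable_const _), mFourierCoeff_const_real]
    rw [hL, hR]
    by_cases hk : k = 0
    · subst hk
      rw [freqNormSq_zero, if_pos rfl, hw0]
      simp
    · rw [if_neg hk, sub_zero]
      have hfpos : 0 < freqNormSq k := lt_of_lt_of_le one_pos (one_le_freqNormSq_of_ne_zero hk)
      have hsplit : (-(4 * Real.pi ^ 2 * freqNormSq k)) ^ N =
          (-(4 * Real.pi ^ 2)) ^ N * freqNormSq k ^ N := by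
        rw [← mul_pow]; ring
      have hreal : c * invLaplacianSymbol k * (-(4 * Real.pi ^ 2 * freqNormSq k)) ^ N = 1 := by
        rw [hc_def, invLaplacianSymbol, ← hN_def, hsplit, ← mul_inv,
          inv_mul_cancel₀ (mul_ne_zero hc0 (pow_ne_zero _ hfpos.ne'))]
      have hA : (-(4 * (Real.pi : ℂ) ^ 2 * (freqNormSq k : ℂ))) =
          ((-(4 * Real.pi ^ 2 * freqNormSq k) : ℝ) : ℂ) := by
        push_cast; ring
      have key : (c : ℂ) * (-(4 * (Real.pi : ℂ) ^ 2 * (freqNormSq k : ℂ))) *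
          (invLaplacianSymbol k : ℂ) * (-(4 * (Real.pi : ℂ) ^ 2 * (freqNormSq k : ℂ))) ^ (N - 1) = 1 := by
        rw [hA]
        calc (c : ℂ) * (((-(4 * Real.pi ^ 2 * freqNormSq k)) : ℝ) : ℂ) * (invLaplacianSymbol k : ℂ) *
              (((-(4 * Real.pi ^ 2 * freqNormSq k)) : ℝ) : ℂ) ^ (N - 1)
            = (c : ℂ) * (invLaplacianSymbol k : ℂ) * ((((-(4 * Real.pi ^ 2 * freqNormSq k)) : ℝ) : ℂ) *
                (((-(4 * Real.pi ^ 2 * freqNormSq k)) : ℝ) : ℂ) ^ (N - 1)) := by ring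
          _ = (c : ℂ) * (invLaplacianSymbol k : ℂ) * (((-(4 * Real.pi ^ 2 * freqNormSq k)) : ℝ) : ℂ) ^ N := by
                rw [← pow_succ', Nat.sub_add_cancel hN]
          _ = ((c * invLaplacianSymbol k * (-(4 * Real.pi ^ 2 * freqNormSq k)) ^ N : ℝ) : ℂ) := by
                push_cast; ring
          _ = 1 := by rw [hreal, Complex.ofReal_one]
      rw [key, one_mul]
  -- conclude by uniqueness of Fourier coefficients
  have hEq := congr_fun (eq_of_forall_mFourierCoeff_eq hF₁c hF₂c hcoef) x
  simp only [hF₁_def, hF₂_def, Complex.ofReal_inj] at hEq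
  exact hEq

/-! ### Joint space–time smoothness -/

/-- Iterated Laplacians of jointly smooth space–time fields are jointly smooth (time sets of unique
differentiability). [folklore] -/
theorem IsSmoothSpaceTimeOn.laplacian_iterate {S : Set ℝ} {u : ℝ → UnitAddTorus d → F}
    (hu : IsSmoothSpaceTimeOn S u) (hS : UniqueDiffOn ℝ S) :
    ∀ n : ℕ, IsSmoothSpaceTimeOn S (fun t => Torus.laplacian^[n] (u t))
  | 0 => hu
  | n + 1 => by
    classical
    have h := (IsSmoothSpaceTimeOn.laplacian_iterate hu hS n).laplacian hS
    simp only [iterate_succ_apply']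
    exact h

/-- **`t ↦ Δ⁻¹(u t)` is jointly smooth on `S × T^d` for jointly smooth `u`**, on every convex time
set with nonempty interior (`[0, T]`, `[0, ∞)`, …; one-sided in time at the endpoints): `Δ⁻¹` is a
mollification of `Δ^{N-1} u(t)` by the integrable kernel `K`, and slice-wise mollification preserves
joint smoothness (`Torus.IsSmoothSpaceTimeOn.convolution`, `TorusSpaceTimeKernel`). This is the form
in which `Δ⁻¹` enters classical space–time constructions (Cheskidov–Luo 2022, §2.6:
`R₀ = ℛ(∂ₜu₀ - Δu₀ + div(u₀ ⊗ u₀))` is smooth on `[0, T] × 𝕋^d`). [cite: CheskidovLuo2022, §7.2] -/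
theorem IsSmoothSpaceTimeOn.invLaplacian {S : Set ℝ} (hS : Convex ℝ S)
    (hSi : (interior S).Nonempty) {u : ℝ → UnitAddTorus d → F} (hu : IsSmoothSpaceTimeOn S u) :
    IsSmoothSpaceTimeOn S (fun t => invLaplacian (u t)) :=
  ((hu.laplacian_iterate (uniqueDiffOn_convex hS hSi) _).convolution integrable_invLaplacianKernel
    hS hSi).const_smul _

end InvLaplacian

end Torus

end Literature.Analysis.FunctionSpaces
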